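import Mathlib
import Summits.Ventures.DiscreteObjects.Mahler.CensusKernelDeg14B
import Summits.Ventures.DiscreteObjects.Mahler.CensusKernelDeg14C
import Summits.Ventures.DiscreteObjects.Mahler.CensusKernelDeg14D
import Summits.Ventures.DiscreteObjects.Mahler.CensusKernelDeg14E
import Summits.Ventures.DiscreteObjects.Mahler.CensusKernelDeg14F
import Summits.Ventures.DiscreteObjects.Mahler.CensusKernelDeg14G
import Summits.Ventures.DiscreteObjects.Mahler.CensusKernelDeg14H
import Summits.Ventures.DiscreteObjects.Mahler.CensusKernelDeg14I
import Summits.Ventures.DiscreteObjects.Mahler.CensusKernelDeg14J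
import Summits.Ventures.DiscreteObjects.Mahler.CensusKernelDeg14K
import Summits.Ventures.DiscreteObjects.Mahler.CensusKernelDeg14L
import Summits.Ventures.DiscreteObjects.Mahler.CensusKernelDeg14M
import Summits.Ventures.DiscreteObjects.Mahler.CensusKernelDeg14N
import Summits.Ventures.DiscreteObjects.Mahler.CensusKernelDeg14O
import Summits.Ventures.DiscreteObjects.Mahler.CensusKernelDeg14P
import Summits.Ventures.DiscreteObjects.Mahler.CensusKernelDeg14Q
import Summits.Ventures.DiscreteObjects.Mahler.CensusKernelDeg14R
import Summits.Ventures.DiscreteObjects.Mahler.CensusKernelDeg14S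
import Summits.Ventures.DiscreteObjects.Mahler.CensusKernelDeg14T
import Summits.Ventures.DiscreteObjects.Mahler.CensusKernelDeg14U
import Summits.Ventures.DiscreteObjects.Mahler.CensusKernelDeg14V

/-!
# Kernel census, degree 14 (part Final): assembly — `degreeCensus_fourteen`

Cell `pub-namedobj`, seat `pub-namedobj-mahler-g13`. Framing: lottery ticket; floor = certified bounds/negative ranges.

Part of the kernel proof of `DegreeCensus 14 (13/10) coresDeg14` (see part A for the method: census search with
Fejér–Riesz cuts, `CensusSearchCuts`; 175415 leaves with `c₁ ≥ 0`, 4502 certified survivors). This last part assembles the node lemmas of parts B… into `certified14` (every survivor with `c₁ ≥ 0` carries a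
valid certificate) and proves `degreeCensus_fourteen : DegreeCensus 14 (13/10) coresDeg14` by
`degreeCensus_of_certified_nonnegC` (`x ↦ -x` symmetry; standard axioms). CONTROL/replication of the published degree-14 list
(Boyd 1980; Mossinghoff 1998; Mossinghoff–Rhin–Wu 2008), not new ground.
-/

namespace Summit.Ventures.DiscreteObjects.Mahler

open Polynomial

/-- Every survivor with `c₁ ≥ 0` of the degree-14 search (with cuts) is certified. -/
theorem certified14 : ∀ a ∈ censusSearchC T14 CT14 7 [] [], 0 ≤ a.getD 0 0 →
    ∃ c, checkCert 13 10 14 coresDeg14 (1 :: palC a) c = true := by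
  intro a ha hsign
  rw [show censusSearchC T14 CT14 7 [] [] = censusSearchC T14 CT14 7 [] (psumsRev [] 0) from rfl,
    mem_censusSearchC_node_iff (pre := []) (n := 0) rfl, (by decide +kernel : nodeLoC T14 CT14 [] (psumsRev [] 0) = -14),
    (by decide +kernel : nodeHiC T14 CT14 [] (psumsRev [] 0) = 14)] at ha
  obtain ⟨a1, ha1, ha⟩ := ha
  simp only [List.nil_append, Nat.reduceAdd] at ha
  rw [getD_zero_of_mem_censusSearchC_cons ha] at hsign
  rw [mem_icc] at ha1
  obtain ⟨hlo1, hhi1⟩ := ha1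
  interval_cases a1
  · rw [mem_censusSearchC_node_iff (pre := [0]) (n := 1) rfl,
      (by decide +kernel : nodeLoC T14 CT14 [0] (psumsRev [0] 1) = -7),
      (by decide +kernel : nodeHiC T14 CT14 [0] (psumsRev [0] 1) = 7)] at ha
    obtain ⟨a2, ha2, ha⟩ := ha
    simp only [List.cons_append, List.nil_append, Nat.reduceAdd] at ha
    rw [mem_icc] at ha2
    obtain ⟨hlo2, hhi2⟩ := ha2
    interval_cases a2
    · exact certified14n_p0_m7 a ha
    · exact certified14n_p0_m6 a ha
    · exact certified14n_p0_m5 a ha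
    · exact certified14n_p0_m4 a ha
    · exact certified14n_p0_m3 a ha
    · exact certified14n_p0_m2 a ha
    · exact certified14n_p0_m1 a ha
    · exact certified14n_p0_p0 a ha
    · exact certified14n_p0_p1 a ha
    · exact certified14n_p0_p2 a ha
    · exact certified14n_p0_p3 a ha
    · exact certified14n_p0_p4 a ha
    · exact certified14n_p0_p5 a ha
    · exact certified14n_p0_p6 a ha
    · exact certified14n_p0_p7 a ha
  · rw [mem_censusSearchC_node_iff (pre := [1]) (n := 1) rfl,
      (by decide +kernel : nodeLoC T14 CT14 [1] (psumsRev [1] 1) = -6),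
      (by decide +kernel : nodeHiC T14 CT14 [1] (psumsRev [1] 1) = 7)] at ha
    obtain ⟨a2, ha2, ha⟩ := ha
    simp only [List.cons_append, List.nil_append, Nat.reduceAdd] at ha
    rw [mem_icc] at ha2
    obtain ⟨hlo2, hhi2⟩ := ha2
    interval_cases a2
    · exact certified14n_p1_m6 a ha
    · exact certified14n_p1_m5 a ha
    · exact certified14n_p1_m4 a ha
    · exact certified14n_p1_m3 a ha
    · exact certified14n_p1_m2 a ha
    · exact certified14n_p1_m1 a ha
    · exact certified14n_p1_p0 a ha
    · exact certified14n_p1_p1 a ha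
    · exact certified14n_p1_p2 a ha
    · exact certified14n_p1_p3 a ha
    · exact certified14n_p1_p4 a ha
    · exact certified14n_p1_p5 a ha
    · exact certified14n_p1_p6 a ha
    · exact certified14n_p1_p7 a ha
  · rw [mem_censusSearchC_node_iff (pre := [2]) (n := 1) rfl,
      (by decide +kernel : nodeLoC T14 CT14 [2] (psumsRev [2] 1) = -5),
      (by decide +kernel : nodeHiC T14 CT14 [2] (psumsRev [2] 1) = 9)] at ha
    obtain ⟨a2, ha2, ha⟩ := ha
    simp only [List.cons_append, List.nil_append, Nat.reduceAdd] at ha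
    rw [mem_icc] at ha2
    obtain ⟨hlo2, hhi2⟩ := ha2
    interval_cases a2
    · exact certified14n_p2_m5 a ha
    · exact certified14n_p2_m4 a ha
    · exact certified14n_p2_m3 a ha
    · exact certified14n_p2_m2 a ha
    · exact certified14n_p2_m1 a ha
    · exact certified14n_p2_p0 a ha
    · exact certified14n_p2_p1 a ha
    · exact certified14n_p2_p2 a ha
    · exact certified14n_p2_p3 a ha
    · exact certified14n_p2_p4 a ha
    · exact certified14n_p2_p5 a ha
    · exact certified14n_p2_p6 a ha
    · exact certified14n_p2_p7 a ha
    · exact certified14n_p2_p8 a ha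
    · exact certified14n_p2_p9 a ha
  · rw [mem_censusSearchC_node_iff (pre := [3]) (n := 1) rfl,
      (by decide +kernel : nodeLoC T14 CT14 [3] (psumsRev [3] 1) = -2),
      (by decide +kernel : nodeHiC T14 CT14 [3] (psumsRev [3] 1) = 11)] at ha
    obtain ⟨a2, ha2, ha⟩ := ha
    simp only [List.cons_append, List.nil_append, Nat.reduceAdd] at ha
    rw [mem_icc] at ha2
    obtain ⟨hlo2, hhi2⟩ := ha2
    interval_cases a2
    · exact certified14n_p3_m2 a ha
    · exact certified14n_p3_m1 a ha
    · exact certified14n_p3_p0 a ha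
    · exact certified14n_p3_p1 a ha
    · exact certified14n_p3_p2 a ha
    · exact certified14n_p3_p3 a ha
    · exact certified14n_p3_p4 a ha
    · exact certified14n_p3_p5 a ha
    · exact certified14n_p3_p6 a ha
    · exact certified14n_p3_p7 a ha
    · exact certified14n_p3_p8 a ha
    · exact certified14n_p3_p9 a ha
    · exact certified14n_p3_p10 a ha
    · exact certified14n_p3_p11 a ha
  · rw [mem_censusSearchC_node_iff (pre := [4]) (n := 1) rfl,
      (by decide +kernel : nodeLoC T14 CT14 [4] (psumsRev [4] 1) = 1),
      (by decide +kernel : nodeHiC T14 CT14 [4] (psumsRev [4] 1) = 14)] at ha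
    obtain ⟨a2, ha2, ha⟩ := ha
    simp only [List.cons_append, List.nil_append, Nat.reduceAdd] at ha
    rw [mem_icc] at ha2
    obtain ⟨hlo2, hhi2⟩ := ha2
    interval_cases a2
    · exact certified14n_p4_p1 a ha
    · exact certified14n_p4_p2 a ha
    · exact certified14n_p4_p3 a ha
    · exact certified14n_p4_p4 a ha
    · exact certified14n_p4_p5 a ha
    · exact certified14n_p4_p6 a ha
    · exact certified14n_p4_p7 a ha
    · exact certified14n_p4_p8 a ha
    · exact certified14n_p4_p9 a ha
    · exact certified14n_p4_p10 a ha
    · exact certified14n_p4_p11 a ha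
    · exact certified14n_p4_p12 a ha
    · exact certified14n_p4_p13 a ha
    · exact certified14n_p4_p14 a ha
  · rw [mem_censusSearchC_node_iff (pre := [5]) (n := 1) rfl,
      (by decide +kernel : nodeLoC T14 CT14 [5] (psumsRev [5] 1) = 6),
      (by decide +kernel : nodeHiC T14 CT14 [5] (psumsRev [5] 1) = 18)] at ha
    obtain ⟨a2, ha2, ha⟩ := ha
    simp only [List.cons_append, List.nil_append, Nat.reduceAdd] at ha
    rw [mem_icc] at ha2
    obtain ⟨hlo2, hhi2⟩ := ha2
    interval_cases a2
    · exact certified14n_p5_p6 a ha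
    · exact certified14n_p5_p7 a ha
    · exact certified14n_p5_p8 a ha
    · exact certified14n_p5_p9 a ha
    · exact certified14n_p5_p10 a ha
    · exact certified14n_p5_p11 a ha
    · exact certified14n_p5_p12 a ha
    · exact certified14n_p5_p13 a ha
    · exact certified14n_p5_p14 a ha
    · exact certified14n_p5_p15 a ha
    · exact certified14n_p5_p16 a ha
    · exact certified14n_p5_p17 a ha
    · exact certified14n_p5_p18 a ha
  · rw [mem_censusSearchC_node_iff (pre := [6]) (n := 1) rfl,
      (by decide +kernel : nodeLoC T14 CT14 [6] (psumsRev [6] 1) = 11),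
      (by decide +kernel : nodeHiC T14 CT14 [6] (psumsRev [6] 1) = 22)] at ha
    obtain ⟨a2, ha2, ha⟩ := ha
    simp only [List.cons_append, List.nil_append, Nat.reduceAdd] at ha
    rw [mem_icc] at ha2
    obtain ⟨hlo2, hhi2⟩ := ha2
    interval_cases a2
    · exact certified14n_p6_p11 a ha
    · exact certified14n_p6_p12 a ha
    · exact certified14n_p6_p13 a ha
    · exact certified14n_p6_p14 a ha
    · exact certified14n_p6_p15 a ha
    · exact certified14n_p6_p16 a ha
    · exact certified14n_p6_p17 a ha
    · exact certified14n_p6_p18 a ha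
    · exact certified14n_p6_p19 a ha
    · exact certified14n_p6_p20 a ha
    · exact certified14n_p6_p21 a ha
    · exact certified14n_p6_p22 a ha
  · rw [mem_censusSearchC_node_iff (pre := [7]) (n := 1) rfl,
      (by decide +kernel : nodeLoC T14 CT14 [7] (psumsRev [7] 1) = 18),
      (by decide +kernel : nodeHiC T14 CT14 [7] (psumsRev [7] 1) = 28)] at ha
    obtain ⟨a2, ha2, ha⟩ := ha
    simp only [List.cons_append, List.nil_append, Nat.reduceAdd] at ha
    rw [mem_icc] at ha2
    obtain ⟨hlo2, hhi2⟩ := ha2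
    interval_cases a2
    · exact certified14n_p7_p18 a ha
    · exact certified14n_p7_p19 a ha
    · exact certified14n_p7_p20 a ha
    · exact certified14n_p7_p21 a ha
    · exact certified14n_p7_p22 a ha
    · exact certified14n_p7_p23 a ha
    · exact certified14n_p7_p24 a ha
    · exact certified14n_p7_p25 a ha
    · exact certified14n_p7_p26 a ha
    · exact certified14n_p7_p27 a ha
    · exact certified14n_p7_p28 a ha
  · rw [mem_censusSearchC_node_iff (pre := [8]) (n := 1) rfl,
      (by decide +kernel : nodeLoC T14 CT14 [8] (psumsRev [8] 1) = 25),
      (by decide +kernel : nodeHiC T14 CT14 [8] (psumsRev [8] 1) = 34)] at ha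
    obtain ⟨a2, ha2, ha⟩ := ha
    simp only [List.cons_append, List.nil_append, Nat.reduceAdd] at ha
    rw [mem_icc] at ha2
    obtain ⟨hlo2, hhi2⟩ := ha2
    interval_cases a2
    · exact certified14n_p8_p25 a ha
    · exact certified14n_p8_p26 a ha
    · exact certified14n_p8_p27 a ha
    · exact certified14n_p8_p28 a ha
    · exact certified14n_p8_p29 a ha
    · exact certified14n_p8_p30 a ha
    · exact certified14n_p8_p31 a ha
    · exact certified14n_p8_p32 a ha
    · exact certified14n_p8_p33 a ha
    · exact certified14n_p8_p34 a ha
  · rw [mem_censusSearchC_node_iff (pre := [9]) (n := 1) rfl,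
      (by decide +kernel : nodeLoC T14 CT14 [9] (psumsRev [9] 1) = 34),
      (by decide +kernel : nodeHiC T14 CT14 [9] (psumsRev [9] 1) = 42)] at ha
    obtain ⟨a2, ha2, ha⟩ := ha
    simp only [List.cons_append, List.nil_append, Nat.reduceAdd] at ha
    rw [mem_icc] at ha2
    obtain ⟨hlo2, hhi2⟩ := ha2
    interval_cases a2
    · exact certified14n_p9_p34 a ha
    · exact certified14n_p9_p35 a ha
    · exact certified14n_p9_p36 a ha
    · exact certified14n_p9_p37 a ha
    · exact certified14n_p9_p38 a ha
    · exact certified14n_p9_p39 a ha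
    · exact certified14n_p9_p40 a ha
    · exact certified14n_p9_p41 a ha
    · exact certified14n_p9_p42 a ha
  · rw [mem_censusSearchC_node_iff (pre := [10]) (n := 1) rfl,
      (by decide +kernel : nodeLoC T14 CT14 [10] (psumsRev [10] 1) = 43),
      (by decide +kernel : nodeHiC T14 CT14 [10] (psumsRev [10] 1) = 50)] at ha
    obtain ⟨a2, ha2, ha⟩ := ha
    simp only [List.cons_append, List.nil_append, Nat.reduceAdd] at ha
    rw [mem_icc] at ha2
    obtain ⟨hlo2, hhi2⟩ := ha2
    interval_cases a2
    · exact certified14n_p10_p43 a ha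
    · exact certified14n_p10_p44 a ha
    · exact certified14n_p10_p45 a ha
    · exact certified14n_p10_p46 a ha
    · exact certified14n_p10_p47 a ha
    · exact certified14n_p10_p48 a ha
    · exact certified14n_p10_p49 a ha
    · exact certified14n_p10_p50 a ha
  · rw [mem_censusSearchC_node_iff (pre := [11]) (n := 1) rfl,
      (by decide +kernel : nodeLoC T14 CT14 [11] (psumsRev [11] 1) = 54),
      (by decide +kernel : nodeHiC T14 CT14 [11] (psumsRev [11] 1) = 59)] at ha
    obtain ⟨a2, ha2, ha⟩ := ha
    simp only [List.cons_append, List.nil_append, Nat.reduceAdd] at ha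
    rw [mem_icc] at ha2
    obtain ⟨hlo2, hhi2⟩ := ha2
    interval_cases a2
    · exact certified14n_p11_p54 a ha
    · exact certified14n_p11_p55 a ha
    · exact certified14n_p11_p56 a ha
    · exact certified14n_p11_p57 a ha
    · exact certified14n_p11_p58 a ha
    · exact certified14n_p11_p59 a ha
  · rw [mem_censusSearchC_node_iff (pre := [12]) (n := 1) rfl,
      (by decide +kernel : nodeLoC T14 CT14 [12] (psumsRev [12] 1) = 65),
      (by decide +kernel : nodeHiC T14 CT14 [12] (psumsRev [12] 1) = 69)] at ha
    obtain ⟨a2, ha2, ha⟩ := ha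
    simp only [List.cons_append, List.nil_append, Nat.reduceAdd] at ha
    rw [mem_icc] at ha2
    obtain ⟨hlo2, hhi2⟩ := ha2
    interval_cases a2
    · exact certified14n_p12_p65 a ha
    · exact certified14n_p12_p66 a ha
    · exact certified14n_p12_p67 a ha
    · exact certified14n_p12_p68 a ha
    · exact certified14n_p12_p69 a ha
  · rw [mem_censusSearchC_node_iff (pre := [13]) (n := 1) rfl,
      (by decide +kernel : nodeLoC T14 CT14 [13] (psumsRev [13] 1) = 78),
      (by decide +kernel : nodeHiC T14 CT14 [13] (psumsRev [13] 1) = 79)] at ha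
    obtain ⟨a2, ha2, ha⟩ := ha
    simp only [List.cons_append, List.nil_append, Nat.reduceAdd] at ha
    rw [mem_icc] at ha2
    obtain ⟨hlo2, hhi2⟩ := ha2
    interval_cases a2
    · exact certified14n_p13_p78 a ha
    · exact certified14n_p13_p79 a ha
  · rw [mem_censusSearchC_node_iff (pre := [14]) (n := 1) rfl,
      (by decide +kernel : nodeLoC T14 CT14 [14] (psumsRev [14] 1) = 91),
      (by decide +kernel : nodeHiC T14 CT14 [14] (psumsRev [14] 1) = 91)] at ha
    obtain ⟨a2, ha2, ha⟩ := ha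
    simp only [List.cons_append, List.nil_append, Nat.reduceAdd] at ha
    rw [mem_icc] at ha2
    obtain ⟨hlo2, hhi2⟩ := ha2
    interval_cases a2
    · exact certified14n_p14_p91 a ha

/-- **Degree-14 census below `13/10` (kernel theorem):** `DegreeCensus 14 (13/10) coresDeg14` — every irreducible
`P ∈ ℤ[X]` of degree `14` with `1 < M(P) < 13/10` is `± c(± x)` for one of the 11 census cores `c14_01 … c14_11`
(Boyd's / Mossinghoff's complete degree-14 list, re-derived inside the kernel: CONTROL/replication row). -/
theorem degreeCensus_fourteen : DegreeCensus 14 (13 / 10) coresDeg14 := by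
  have h := degreeCensus_of_certified_nonnegC (Bn := 13) (Bd := 10) (d := 7) (by norm_num) (by norm_num) (by decide)
    thresholdsValid_T14 cutTableValid_CT14 (by have := smythTheta_gt; push_cast; linarith) certified14
  norm_num at h
  exact h

end Summit.Ventures.DiscreteObjects.Mahler
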